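import Literature.Probability.Percolation.StaircaseSeparation
import Literature.Probability.Percolation.ArmSeparationSlotSep
import HarnessLib

/-!
# From ring-index gaps to lateral separation on a thin ring

Topic: Probability / Percolation; family `crit-perc`. A brick of the GENERIC landing layer of
Nolin's arm-separation theorem (Nolin 2008, Thm. 11, §4.4 [arXiv 0711.4948: Thm. 10, p. 12,
Fig. 6: "RSW in corridors"]), towards
`Literature.Probability.Percolation.Nolin2008_prop17_quasiMult` (`FiveArmExponentFacts.lean`).

The schedule of the staircase corridors keeps the ring-INDEX intervals of different corridors
on one ring at cyclic distance at least `D`; the separation lemma `ringTube_disjoint_ringTube`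
(`StaircaseSeparation.lean`) wants LATERAL separation (`Staircase.LatSep`) of the two tubes'
(side, lateral index). This file bridges the two: positions at cyclic index distance `≥ 12`
have laterally separated (side, lateral index) (`latSep_of_index_gap`), by the pinning
`pos_le_of_side_lat` of a position between the piece of its (side, lateral index) and the next
position, and the block offsets of the six sides.

## Main results

* `Staircase.latSep_of_index_gap`, `Staircase.ringTube_disjoint_of_index_gap`.

## References

* P. Nolin, *Near-critical percolation in two dimensions*, Electron. J. Probab. 13 (2008), §4.3
  Prop. 12 (proof), §4.4 (arXiv 0711.4948: Prop. 11; proof of Thm. 10, p. 12, Fig. 6). [Nolin2008]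
-/

noncomputable section

namespace Literature.Probability.Percolation

open LatticeModels Tube

namespace Staircase

/-- **Index gap gives lateral separation**: two positions `g, g'` of the thin ring with `n`
chunks per side (`G = 12n - 4` positions) at cyclic distance at least `12` — linearly
(`g + 12 ≤ g'` or `g' + 12 ≤ g`) and around (`g' + 12 ≤ g + G`, `g + 12 ≤ g' + G`) — have
laterally separated (side, lateral index). [folklore] -/
theorem latSep_of_index_gap {r s g g' : ℕ} (hr : 1 ≤ r / s) (hg : g < 12 * (r / s) - 4) (hg' : g' < 12 * (r / s) - 4)
    (hlin : g + 12 ≤ g' ∨ g' + 12 ≤ g) (hwrap : g' + 12 ≤ g + (12 * (r / s) - 4) ∧ g + 12 ≤ g' + (12 * (r / s) - 4)) :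
    LatSep (r / s) (ringSide r s g) (ringLat r s g) (ringSide r s g') (ringLat r s g') := by
  obtain ⟨hp1, hp2⟩ := pos_le_of_side_lat hr hg
  obtain ⟨hp1', hp2'⟩ := pos_le_of_side_lat hr hg'
  have hi6 := ringSide_lt r s g
  have hi6' := ringSide_lt r s g'
  have hlt := ringLat_lt (r := r) (s := s) (g := g) hr
  have hlt' := ringLat_lt (r := r) (s := s) (g := g') hr
  generalize ringSide r s g = i at *
  generalize ringSide r s g' = i' at *
  generalize ringLat r s g = l at *
  generalize ringLat r s g' = l' at *
  generalize r / s = n at *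
  unfold LatSep toEnd fromStart
  unfold piecePos blockOff at hp1 hp2 hp1' hp2'
  interval_cases i <;> interval_cases i' <;>
    simp only [Nat.reduceMod, Nat.reduceEqDiff, reduceIte, true_and, false_and, and_false,
      false_or, or_false, ne_eq, not_true_eq_false, not_false_eq_true] at hp1 hp2 hp1' hp2' ⊢ <;> omega

/-- **Ring tubes at cyclic index distance at least `12` are disjoint** (`1 ≤ r / s`, `s ∣ r`,
`4e ≤ s`, `2s + 8e ≤ r`). [cite: Nolin2008, §4.3 Prop. 12 (proof) (arXiv 0711.4948: Prop. 11), corridors kept apart] -/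
theorem ringTube_disjoint_of_index_gap {r e s g g' : ℕ} (hr : 1 ≤ r / s) (hsr : s ∣ r) (hes : 4 * e ≤ s) (hsr2 : 2 * s + 8 * e ≤ r)
    (hg : g < 12 * (r / s) - 4) (hg' : g' < 12 * (r / s) - 4)
    (hlin : g + 12 ≤ g' ∨ g' + 12 ≤ g) (hwrap : g' + 12 ≤ g + (12 * (r / s) - 4) ∧ g + 12 ≤ g' + (12 * (r / s) - 4)) :
    Disjoint (ringTube r e s g).box (ringTube r e s g').box :=
  ringTube_disjoint_ringTube hr hsr hes hsr2 hg hg' (latSep_of_index_gap hr hg hg' hlin hwrap)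

end Staircase

end Literature.Probability.Percolation
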